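import Literature.Analysis.OperatorTheory.TwistedKernelFluxSectors
import Literature.Analysis.OperatorTheory.HilbertSchmidtPairing
import Literature.Analysis.OperatorTheory.CompactSelfAdjointEigenbasis
import Literature.Analysis.OperatorTheory.PathKernelDomination
import HarnessLib

/-!
# The flux-free sector of a positive transfer operator under a finite abelian symmetry group IS a spectral
# trace: `|Γ|⁻¹ Σ_k Tr(U_{T_k} A^{M+2}) = Σ_j ν_j^{M+2}` with `ν_j ≥ 0` listed WITH (integer) multiplicity

Topic `Literature/Analysis/OperatorTheory`; sequel of `TwistedKernelFluxSectors.lean` ('t Hooft's electric-flux sectors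
`z_ψ(M+2) = |Γ|⁻¹ Σ_k conj ψ(k) z k (M+2)` of a bounded symmetric kernel `K` under a finite abelian group `Γ` of
measure-preserving twists `T k`, and the trace formula `z_ψ(M+2) = Σᵢ λᵢ^M qᵢ(ψ)` over an eigenbasis of the `L²` operator
`A` of `K`, with REAL weights `qᵢ(ψ) = ‖P_ψ κbᵢ‖² ∈ [0, λᵢ²]`).  For the purity ∕ spectral-gap bookkeeping of the
trace `Tr P e^{−tH}` ('t Hooft 1979 (5.1): «P is a projection operator that selects the required electric flux») one
needs the sector as a GENUINE spectral trace — eigenvalues of the compressed operator `A P = P A P` counted with their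
integer multiplicities — not a weighted one.  This file proves exactly that for the trivial character, with no joint
eigenbasis and no complexification (everything on the real `L²`):

* §1 (abstract real Hilbert space).  For bounded `A, P` with `P A = A P`, `P² = P` and an orthonormal eigenvector
  `(A P) v = ν v`: `⟪P A^{M+1} v, A v⟫ = ν^{M+2}` (`inner_proj_pow_apply_eq_pow`); if moreover `0 ≤ ⟪x, A x⟫` for all `x`
  then `ν ≥ 0` (`eigenvalue_mul_proj_nonneg`); ★ `hasSum_pow_eigenvalues_of_hasSum_inner` — for a Hilbert basis `(bᵢ)`
  of eigenvectors of `A` with `Σ λᵢ² < ∞` and a Hilbert basis `(b'_j)` of eigenvectors of `A P` with eigenvalues `ν_j`,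
  `Σᵢ ⟪P A^{M+1} bᵢ, A bᵢ⟫ = s ⇒ Σ_j ν_j^{M+2} = s` (Hilbert–Schmidt pairing is basis independent,
  `tsum_inner_apply_apply_eq_of_hilbertBasis`, Reed–Simon I Thm VI.24); `exists_eigenbasis_mul_proj` (Hilbert–Schmidt
  theorem for the compact self-adjoint `A P`), `summable_sq_eigenvalues_mul_proj`.
* §2 (kernels).  The Koopman operators `U_k f = f ∘ T_k` of a measure-preserving action (`T 0 = id`,
  `T (k + k') = T k ∘ T k'`) on real `L²` (Mathlib's `Lp.compMeasurePreserving`): group law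
  (`compMeasurePreserving_action_add`), `⟪U_k f, g⟫ = ⟪f, U_{−k} g⟫` (`inner_compMeasurePreserving_action`), and for a
  `T`-invariant kernel `A U_k = U_k A` (`kernelOp_compMeasurePreserving_action`); `inner_compMeasurePreserving_kernelOp`
  (`⟪U_k Aφ, Aφ⟫ = ∫ (κφ)(T_k x)(κφ)(x) dμ`, 't Hooft's `⟨n|Ω[k]|n⟩`).
* §3 `averagingProjection_props` — the AVERAGING PROJECTION `P = |Γ|⁻¹ Σ_k U_k` commutes with `A`, is idempotent and
  self-adjoint ('t Hooft's `P(e = 0) = N⁻³ Σ_k Ω[k]`, (5.2); Serre's projection onto the invariants).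
* ★★ `exists_spectralData_fluxSector_zero` — MAIN: for a bounded, strongly measurable, symmetric kernel of POSITIVE
  TYPE, invariant under the action, and twisted traces `z k (M+2) = ∫ (κ^{[M+1]} K(·,x))(T_k x) dμ`, there are
  `ν_j ≥ 0` with `Σ ν_j² < ∞` and **`|Γ|⁻¹ Σ_k z k (M+2) = Σ_j ν_j^{M+2}` for every `M`** — 't Hooft's
  `e^{−βF(e=0)} = Tr P(0) e^{−βH} = Σ_{states with e = 0} e^{−βE_n}` ((5.1)–(5.3)) as an unconditional sum over a Hilbert
  basis of eigenvectors of `P 𝕋 P`; `re_fluxSector_zero_eq` rewrites the complex `ψ = 0` sector of the companion file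
  as this real average.

HONEST FRAMING: transfer-operator bookkeeping on one finite measure space; no rate, no limit, nothing about a mass gap.
Consumers: the projected twisted slab `projSlabZ` of `Summits/QuantumFields/YangMills` (crux `IRcof`, line
`twisted-slab-continuity`, stub T1) — its purity propagation needs integer multiplicities.

References: G. 't Hooft, Nucl. Phys. B 153 (1979) 141, §4 (4.2)–(4.5), §5 (5.1)–(5.3); M. Reed, B. Simon, *Methods of
Modern Mathematical Physics* I (1980) Thm VI.16, VI.22–24; J.-P. Serre, *Linear Representations of Finite Groups* (1977)
§2.6 Thm 8 (the projection `p = |G|⁻¹ Σ_t ρ_t` onto the invariants).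
-/

noncomputable section

namespace Literature.Analysis.OperatorTheory

open MeasureTheory Filter Set Function Finset
open scoped RealInnerProductSpace ENNReal BigOperators

/-! ### §1 Abstract: the compressed operator `A P` and its eigen-traces -/

section Abstract

variable {E : Type*} [NormedAddCommGroup E] [InnerProductSpace ℝ E] [CompleteSpace E]

omit [CompleteSpace E] in
/-- Powers of `A` act diagonally on an eigenvector. [cite: ReedSimonI1980, Thm. VI.16] -/
theorem pow_apply_of_apply_eq_smul {A : E →L[ℝ] E} {v : E} {ν : ℝ} (hv : A v = ν • v) (n : ℕ) :
    (A ^ n) v = ν ^ n • v := by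
  induction n with
  | zero => simp
  | succ n ih => rw [pow_succ, mul_apply_eq_comp, hv, map_smul, ih, smul_smul, pow_succ, mul_comm]

omit [CompleteSpace E] in
/-- **Eigenvectors of `A P` with non-zero eigenvalue are `P`-invariant eigenvectors of `A`**: if `P A = A P`, `P² = P`
and `(A P) v = ν v` with `ν ≠ 0`, then `P v = v` and `A v = ν v`. [cite: tHooft1979Flux, §5 (5.1)–(5.2)] -/
theorem proj_apply_eq_self_of_eigenvector {A P : E →L[ℝ] E} (hPA : P * A = A * P) (hPP : P * P = P) {v : E} {ν : ℝ}
    (hν : ν ≠ 0) (hv : (A * P) v = ν • v) : P v = v ∧ A v = ν • v := by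
  have hPv : P v = v := by
    have h1 : P ((A * P) v) = ν • P v := by rw [hv, map_smul]
    have h2 : P ((A * P) v) = (A * P) v := by
      rw [← mul_apply_eq_comp, ← mul_assoc, hPA, mul_assoc, hPP]
    rw [h2, hv] at h1
    have h3 : ν • (P v - v) = 0 := by rw [smul_sub, ← h1, sub_self]
    rcases smul_eq_zero.1 h3 with h | h
    · exact absurd h hν
    · exact sub_eq_zero.1 h
  refine ⟨hPv, ?_⟩
  have h : A v = (A * P) v := by rw [mul_apply_eq_comp, hPv]
  rw [h, hv]

omit [CompleteSpace E] in
/-- **The eigen-trace term**: for `P A = A P`, `P² = P` and a unit eigenvector `(A P) v = ν v`,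
`⟪P A^{M+1} v, A v⟫ = ν^{M+2}` (for `ν ≠ 0` the vector is `P`-invariant; for `ν = 0` both sides vanish since
`P A^{M+1} = A^M (A P)`). [cite: tHooft1979Flux, §5 (5.1)–(5.3)] [cite: ReedSimonI1980, Thm. VI.22–23] -/
theorem inner_proj_pow_apply_eq_pow {A P : E →L[ℝ] E} (hPA : P * A = A * P) (hPP : P * P = P) {v : E}
    (hv1 : ‖v‖ = 1) {ν : ℝ} (hv : (A * P) v = ν • v) (M : ℕ) :
    ⟪(P * A ^ (M + 1)) v, A v⟫ = ν ^ (M + 2) := by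
  have hcomm : P * A ^ (M + 1) = A ^ M * (A * P) := by
    have hc : Commute P A := hPA
    rw [(hc.pow_right (M + 1)).eq, pow_succ, mul_assoc]
  by_cases hν : ν = 0
  · subst hν
    rw [hcomm, mul_apply_eq_comp, hv, zero_smul, map_zero, inner_zero_left, zero_pow (by omega)]
  · obtain ⟨hPv, hAv⟩ := proj_apply_eq_self_of_eigenvector hPA hPP hν hv
    rw [hcomm, mul_apply_eq_comp, hv, map_smul, pow_apply_of_apply_eq_smul hAv M, hAv, smul_smul,
      real_inner_smul_left, real_inner_smul_right, real_inner_self_eq_norm_sq, hv1]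
    ring

omit [CompleteSpace E] in
/-- **Eigenvalues of `A P` are non-negative** when `A ≥ 0` (`0 ≤ ⟪x, A x⟫`), `P A = A P`, `P² = P`.
[cite: tHooft1979Flux, §5 (5.1)] -/
theorem eigenvalue_mul_proj_nonneg {A P : E →L[ℝ] E} (hApos : ∀ x, 0 ≤ ⟪x, A x⟫) (hPA : P * A = A * P)
    (hPP : P * P = P) {v : E} (hv1 : ‖v‖ = 1) {ν : ℝ} (hv : (A * P) v = ν • v) : 0 ≤ ν := by
  by_cases hν : ν = 0
  · exact hν.symm.le
  · obtain ⟨-, hAv⟩ := proj_apply_eq_self_of_eigenvector hPA hPP hν hv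
    have h := hApos v
    rwa [hAv, real_inner_smul_right, real_inner_self_eq_norm_sq, hv1, one_pow, mul_one] at h

/-- **Hilbert–Schmidt theorem for the compressed operator**: for compact self-adjoint `A` and self-adjoint `P` commuting
with it, `A P` is compact self-adjoint and has a Hilbert basis of eigenvectors with real eigenvalues.
[cite: ReedSimonI1980, Thm. VI.16] -/
theorem exists_eigenbasis_mul_proj {A P : E →L[ℝ] E} (hA : IsCompactOperator A) (hAsa : IsSelfAdjoint A)
    (hPsa : IsSelfAdjoint P) (hPA : P * A = A * P) :
    ∃ (s : Set E) (b' : HilbertBasis s ℝ E) (ν : s → ℝ), ⇑b' = ((↑) : s → E) ∧ ∀ j, (A * P) (b' j) = ν j • b' j := by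
  have hcpt : IsCompactOperator (A * P) := by
    have h := hA.comp_clm P
    exact h
  have hsa : IsSelfAdjoint (A * P) := (IsSelfAdjoint.commute_iff hAsa hPsa).1 hPA.symm
  obtain ⟨s, b', ν, hb', h⟩ := exists_hilbertBasis_eigenvectors_of_isSelfAdjoint hcpt hsa
  exact ⟨s, b', ν, hb', fun j => by simpa using h j⟩

/-- The Hilbert–Schmidt data transported to an eigenbasis of `A P`: `Σ_j ν_j² = Σ_j ‖A P b'_j‖² < ∞` when
`Σᵢ ‖A bᵢ‖² = Σ λᵢ² < ∞` along an eigenbasis of `A` (`P A = A P`, `‖P A bᵢ‖ ≤ ‖P‖ |λᵢ|`; basis independence of the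
Hilbert–Schmidt norm). [cite: ReedSimonI1980, Thm. VI.22 (c)–(d)] -/
theorem summable_sq_eigenvalues_mul_proj {ι ι' : Type*} (b : HilbertBasis ι ℝ E) (b' : HilbertBasis ι' ℝ E)
    {A P : E →L[ℝ] E} {lam : ι → ℝ} (hb : ∀ i, A (b i) = lam i • b i) (hlam : Summable fun i => lam i ^ 2)
    (hPA : P * A = A * P) {ν : ι' → ℝ} (hb' : ∀ j, (A * P) (b' j) = ν j • b' j) :
    Summable fun j => ν j ^ 2 := by
  have h1 : Summable fun i => ‖(A * P) (b i)‖ ^ 2 := by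
    refine (hlam.mul_left (‖P‖ ^ 2)).of_nonneg_of_le (fun i => sq_nonneg _) fun i => ?_
    rw [← hPA, mul_apply_eq_comp, hb, map_smul, norm_smul, Real.norm_eq_abs, mul_pow, sq_abs, mul_comm]
    gcongr
    calc ‖P (b i)‖ ≤ ‖P‖ * ‖b i‖ := P.le_opNorm _
      _ = ‖P‖ := by rw [b.orthonormal.norm_eq_one i, mul_one]
  have h2 := hasSum_norm_sq_apply_of_hasSum b b' (A * P) h1.hasSum
  refine h2.summable.congr fun j => ?_
  rw [hb', norm_smul, Real.norm_eq_abs, b'.orthonormal.norm_eq_one j, mul_one, sq_abs]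

/-- ★ **The compressed trace in an eigenbasis of `A P`**: if `Σᵢ ⟪P A^{M+1} bᵢ, A bᵢ⟫ = s` along a Hilbert basis of
eigenvectors of `A` (`A bᵢ = λᵢ bᵢ`, `Σ λᵢ² < ∞`), then `Σ_j ν_j^{M+2} = s` along any Hilbert basis of eigenvectors of
`A P` (`P A = A P`, `P² = P`) — the pairing `Σ ⟪S eᵢ, R eᵢ⟩` of two Hilbert–Schmidt operators does not depend on the
basis (Reed–Simon I Thm VI.24), and termwise `⟪P A^{M+1} b'_j, A b'_j⟫ = ν_j^{M+2}`.
[cite: ReedSimonI1980, Thm. VI.22–24] [cite: tHooft1979Flux, §5 (5.1)–(5.3)] -/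
theorem hasSum_pow_eigenvalues_of_hasSum_inner {ι ι' : Type*} (b : HilbertBasis ι ℝ E) (b' : HilbertBasis ι' ℝ E)
    {A P : E →L[ℝ] E} {lam : ι → ℝ} (hb : ∀ i, A (b i) = lam i • b i) (hlam : Summable fun i => lam i ^ 2)
    (hPA : P * A = A * P) (hPP : P * P = P) {ν : ι' → ℝ} (hb' : ∀ j, (A * P) (b' j) = ν j • b' j)
    (M : ℕ) {s : ℝ} (hs : HasSum (fun i => ⟪(P * A ^ (M + 1)) (b i), A (b i)⟫) s) :
    HasSum (fun j => ν j ^ (M + 2)) s := by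
  have hlamA : ∀ i, |lam i| ≤ ‖A‖ := fun i => by
    have h1 : ‖A (b i)‖ = |lam i| := by
      rw [hb, norm_smul, Real.norm_eq_abs, b.orthonormal.norm_eq_one i, mul_one]
    rw [← h1]
    calc ‖A (b i)‖ ≤ ‖A‖ * ‖b i‖ := A.le_opNorm _
      _ = ‖A‖ := by rw [b.orthonormal.norm_eq_one i, mul_one]
  -- both factors are Hilbert–Schmidt along `b`
  have hS : Summable fun i => ‖(P * A ^ (M + 1)) (b i)‖ ^ 2 := by
    refine (hlam.mul_left (‖P‖ ^ 2 * (‖A‖ ^ 2) ^ M)).of_nonneg_of_le (fun i => sq_nonneg _) fun i => ?_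
    rw [mul_apply_eq_comp, pow_apply_of_apply_eq_smul (hb i) (M + 1), map_smul, norm_smul,
      Real.norm_eq_abs, mul_pow, sq_abs]
    have hP : ‖P (b i)‖ ^ 2 ≤ ‖P‖ ^ 2 := by
      refine pow_le_pow_left₀ (norm_nonneg _) ?_ 2
      calc ‖P (b i)‖ ≤ ‖P‖ * ‖b i‖ := P.le_opNorm _
        _ = ‖P‖ := by rw [b.orthonormal.norm_eq_one i, mul_one]
    have hl2 : lam i ^ 2 ≤ ‖A‖ ^ 2 := by
      rw [← sq_abs]; exact pow_le_pow_left₀ (abs_nonneg _) (hlamA i) 2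
    have hl : (lam i ^ (M + 1)) ^ 2 ≤ (‖A‖ ^ 2) ^ M * lam i ^ 2 := by
      rw [← pow_mul, mul_comm, pow_mul, pow_succ]
      exact mul_le_mul_of_nonneg_right (pow_le_pow_left₀ (sq_nonneg _) hl2 M) (sq_nonneg _)
    calc (lam i ^ (M + 1)) ^ 2 * ‖P (b i)‖ ^ 2 ≤ ((‖A‖ ^ 2) ^ M * lam i ^ 2) * ‖P‖ ^ 2 :=
          mul_le_mul hl hP (sq_nonneg _) (by positivity)
      _ = ‖P‖ ^ 2 * (‖A‖ ^ 2) ^ M * lam i ^ 2 := by ring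
  have hR : Summable fun i => ‖A (b i)‖ ^ 2 := by
    refine hlam.congr fun i => ?_
    rw [hb, norm_smul, Real.norm_eq_abs, b.orthonormal.norm_eq_one i, mul_one, sq_abs]
  have h := hasSum_inner_apply_apply_of_hasSum b b' (P * A ^ (M + 1)) A hS hR hs
  exact h.congr_fun fun j => (inner_proj_pow_apply_eq_pow hPA hPP (b'.orthonormal.norm_eq_one j) (hb' j) M).symm

end Abstract

/-! ### §2 Koopman operators of a measure-preserving action on real `L²` -/

section Koopman

variable {X : Type*} [MeasurableSpace X] {μ : Measure X} [IsFiniteMeasure μ]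
  {Γ : Type*} [AddCommGroup Γ] {T : Γ → X → X}

omit [MeasurableSpace X] [IsFiniteMeasure μ] in
/-- The action is by bijections: `T (−k) (T k x) = x`. [cite: tHooft1979Flux, §4 (4.4)] -/
theorem action_neg_apply (hT0 : T 0 = id) (hTadd : ∀ k k' x, T (k + k') x = T k (T k' x)) (k : Γ) (x : X) :
    T (-k) (T k x) = x := by
  rw [← hTadd, neg_add_cancel, hT0, id]

omit [IsFiniteMeasure μ] [AddCommGroup Γ] in
/-- Substitution under a measure-preserving map: `∫ F (T k x) dμ = ∫ F dμ` for a.e.-strongly measurable `F`.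
[cite: ReedSimonI1980, Thm. VI.22–23] -/
theorem integral_comp_action (hT : ∀ k, MeasurePreserving (T k) μ μ) (k : Γ) {F : X → ℝ}
    (hF : AEStronglyMeasurable F μ) : ∫ x, F (T k x) ∂μ = ∫ x, F x ∂μ := by
  have h := integral_map (μ := μ) (hT k).measurable.aemeasurable (f := F) (by rw [(hT k).map_eq]; exact hF)
  rw [(hT k).map_eq] at h
  exact h.symm

omit [IsFiniteMeasure μ] [AddCommGroup Γ] in
/-- The Koopman operator is linear (Mathlib's `Lp.compMeasurePreserving` is bundled additively; the scalar law is that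
of `Lp.compMeasurePreservingₗ`). [cite: ReedSimonI1980, Thm. VI.22–23] -/
theorem compMeasurePreserving_action_smul (hT : ∀ k, MeasurePreserving (T k) μ μ) (k : Γ) (c : ℝ)
    (f : Lp ℝ 2 μ) :
    Lp.compMeasurePreserving (T k) (hT k) (c • f) = c • Lp.compMeasurePreserving (T k) (hT k) f :=
  (Lp.compMeasurePreservingₗ ℝ (T k) (hT k)).map_smul c f

omit [IsFiniteMeasure μ] in
/-- **Group law of the Koopman operators**: `U_{k'} (U_k f) = U_{k + k'} f` on `L²` (`U_k f = f ∘ T_k`,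
`T (k + k') = T k ∘ T k'`). [cite: tHooft1979Flux, §4 (4.4)] -/
theorem compMeasurePreserving_action_add (hT : ∀ k, MeasurePreserving (T k) μ μ)
    (hTadd : ∀ k k' x, T (k + k') x = T k (T k' x)) (k k' : Γ) (f : Lp ℝ 2 μ) :
    Lp.compMeasurePreserving (T k') (hT k') (Lp.compMeasurePreserving (T k) (hT k) f) =
      Lp.compMeasurePreserving (T (k + k')) (hT (k + k')) f := by
  refine Lp.ext ?_
  have h1 := Lp.coeFn_compMeasurePreserving (Lp.compMeasurePreserving (T k) (hT k) f) (hT k')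
  have h2 : (Lp.compMeasurePreserving (T k) (hT k) f : X → ℝ) ∘ T k' =ᵐ[μ] (f ∘ T k) ∘ T k' := by
    refine ae_eq_comp (hT k').measurable.aemeasurable ?_
    rw [(hT k').map_eq]
    exact Lp.coeFn_compMeasurePreserving f (hT k)
  have h3 := Lp.coeFn_compMeasurePreserving f (hT (k + k'))
  refine (h1.trans h2).trans (h3.trans ?_).symm
  exact Eventually.of_forall fun x => by simp only [Function.comp_apply, hTadd]

omit [IsFiniteMeasure μ] in
/-- **The adjoint of `U_k` is `U_{−k}`**: `⟪U_k f, g⟫ = ⟪f, U_{−k} g⟫` (substitute `x = T_{−k} y`; the action preserves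
`μ`). [cite: tHooft1979Flux, §4 (4.3)–(4.4)] -/
theorem inner_compMeasurePreserving_action (hT : ∀ k, MeasurePreserving (T k) μ μ) (hT0 : T 0 = id)
    (hTadd : ∀ k k' x, T (k + k') x = T k (T k' x)) (k : Γ) (f g : Lp ℝ 2 μ) :
    ⟪Lp.compMeasurePreserving (T k) (hT k) f, g⟫ = ⟪f, Lp.compMeasurePreserving (T (-k)) (hT (-k)) g⟫ := by
  rw [inner_eq_integral, inner_eq_integral]
  have hg : AEStronglyMeasurable (fun x => g (T (-k) x)) μ :=
    (Lp.aestronglyMeasurable g).comp_quasiMeasurePreserving (hT (-k)).quasiMeasurePreserving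
  have hF : AEStronglyMeasurable (fun x => f x * g (T (-k) x)) μ := (Lp.aestronglyMeasurable f).mul hg
  calc ∫ x, (Lp.compMeasurePreserving (T k) (hT k) f) x * g x ∂μ = ∫ x, f (T k x) * g x ∂μ := by
        refine integral_congr_ae ?_
        filter_upwards [Lp.coeFn_compMeasurePreserving f (hT k)] with x hx
        rw [hx, Function.comp_apply]
    _ = ∫ x, (fun y => f y * g (T (-k) y)) (T k x) ∂μ := by
        refine integral_congr_ae (Eventually.of_forall fun x => ?_)
        simp only [action_neg_apply hT0 hTadd]
    _ = ∫ y, f y * g (T (-k) y) ∂μ := integral_comp_action hT k hF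
    _ = ∫ y, f y * (Lp.compMeasurePreserving (T (-k)) (hT (-k)) g) y ∂μ := by
        refine integral_congr_ae ?_
        filter_upwards [Lp.coeFn_compMeasurePreserving g (hT (-k))] with y hy
        rw [hy, Function.comp_apply]

omit [IsFiniteMeasure μ] in
/-- **A `T`-invariant kernel operator commutes with the Koopman operators**: `A (U_k f) = U_k (A f)` for
`K (T_k x) (T_k y) = K x y` (substitute `y = T_{−k} y'` in `∫ K(x,y) f(T_k y) dμ(y)`).
[cite: tHooft1979Flux, §4 (4.4)] [cite: ReedSimonI1980, Thm. VI.22–23] -/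
theorem kernelOp_compMeasurePreserving_action {K : X → X → ℝ} {A : Lp ℝ 2 μ →L[ℝ] Lp ℝ 2 μ}
    (hK : StronglyMeasurable (uncurry K))
    (hA : ∀ φ : Lp ℝ 2 μ, (A φ : X → ℝ) =ᵐ[μ] fun x => ∫ y, K x y * φ y ∂μ)
    (hT : ∀ k, MeasurePreserving (T k) μ μ) (hT0 : T 0 = id) (hTadd : ∀ k k' x, T (k + k') x = T k (T k' x))
    (hKT : ∀ k x y, K (T k x) (T k y) = K x y) (k : Γ) (f : Lp ℝ 2 μ) :
    A (Lp.compMeasurePreserving (T k) (hT k) f) = Lp.compMeasurePreserving (T k) (hT k) (A f) := by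
  refine Lp.ext ?_
  have hKx : ∀ x, Measurable (K x) := fun x => hK.measurable.comp measurable_prodMk_left
  -- invariance in the form `K (T k x) y = K x (T (-k) y)`
  have hKT' : ∀ x y, K (T k x) y = K x (T (-k) y) := fun x y => by
    rw [← hKT k x (T (-k) y), ← hTadd, add_neg_cancel, hT0, id_eq]
  -- left side
  have hL : (A (Lp.compMeasurePreserving (T k) (hT k) f) : X → ℝ) =ᵐ[μ]
      fun x => ∫ y, K (T k x) y * f y ∂μ := by
    filter_upwards [hA (Lp.compMeasurePreserving (T k) (hT k) f)] with x hx
    rw [hx]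
    have h1 : ∫ y, K x y * (Lp.compMeasurePreserving (T k) (hT k) f) y ∂μ = ∫ y, K x y * f (T k y) ∂μ := by
      refine integral_congr_ae ?_
      filter_upwards [Lp.coeFn_compMeasurePreserving f (hT k)] with y hy
      rw [hy, Function.comp_apply]
    have hF : AEStronglyMeasurable (fun y => K x (T (-k) y) * f y) μ :=
      (((hKx x).comp (hT (-k)).measurable).aestronglyMeasurable).mul (Lp.aestronglyMeasurable f)
    have h2 : ∫ y, K x y * f (T k y) ∂μ = ∫ y, (fun y' => K x (T (-k) y') * f y') (T k y) ∂μ := by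
      refine integral_congr_ae (Eventually.of_forall fun y => ?_)
      simp only [action_neg_apply hT0 hTadd]
    rw [h1, h2, integral_comp_action hT k hF]
    exact integral_congr_ae (Eventually.of_forall fun y => by simp only [hKT'])
  -- right side
  have hR : (Lp.compMeasurePreserving (T k) (hT k) (A f) : X → ℝ) =ᵐ[μ] fun x => ∫ y, K (T k x) y * f y ∂μ := by
    have h1 := Lp.coeFn_compMeasurePreserving (A f) (hT k)
    have h2 : (A f : X → ℝ) ∘ T k =ᵐ[μ] (fun x => ∫ y, K x y * f y ∂μ) ∘ T k := by
      refine ae_eq_comp (hT k).measurable.aemeasurable ?_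
      rw [(hT k).map_eq]
      exact hA f
    exact h1.trans h2
  exact hL.trans hR.symm

omit [IsFiniteMeasure μ] [AddCommGroup Γ] in
/-- **The flux-free coefficient as an inner product**: for the honest function `c = κφ` of `A φ`,
`⟪U_k (A φ), A φ⟫ = ∫ c (T_k x) c(x) dμ` — 't Hooft's `⟨n|Ω[k]|n⟩`. [cite: tHooft1979Flux, §5 (5.3)] -/
theorem inner_compMeasurePreserving_kernelOp {K : X → X → ℝ} {A : Lp ℝ 2 μ →L[ℝ] Lp ℝ 2 μ}
    (hA : ∀ φ : Lp ℝ 2 μ, (A φ : X → ℝ) =ᵐ[μ] fun x => ∫ y, K x y * φ y ∂μ)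
    (hT : ∀ k, MeasurePreserving (T k) μ μ) (k : Γ) (φ : Lp ℝ 2 μ) :
    ⟪Lp.compMeasurePreserving (T k) (hT k) (A φ), A φ⟫ =
      ∫ x, (∫ z, K (T k x) z * φ z ∂μ) * (∫ z, K x z * φ z ∂μ) ∂μ := by
  rw [inner_eq_integral]
  refine integral_congr_ae ?_
  have h1 := Lp.coeFn_compMeasurePreserving (A φ) (hT k)
  have h2 : (A φ : X → ℝ) ∘ T k =ᵐ[μ] (fun x => ∫ y, K x y * φ y ∂μ) ∘ T k := by
    refine ae_eq_comp (hT k).measurable.aemeasurable ?_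
    rw [(hT k).map_eq]
    exact hA φ
  filter_upwards [h1.trans h2, hA φ] with x hx hx'
  rw [hx, hx', Function.comp_apply]

end Koopman

/-! ### §3 The averaging projection and the flux-free sector as a spectral trace -/

section Sector

variable {X : Type*} [MeasurableSpace X] {μ : Measure X} [IsFiniteMeasure μ]
  {K : X → X → ℝ} {C : ℝ} {A : Lp ℝ 2 μ →L[ℝ] Lp ℝ 2 μ} {ι : Type*}
  {b : HilbertBasis ι ℝ (Lp ℝ 2 μ)} {lam : ι → ℝ}
  {Γ : Type*} [AddCommGroup Γ] [Fintype Γ] {T : Γ → X → X}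

omit [IsFiniteMeasure μ] in
/-- **'t Hooft's flux projection `P(0) = |Γ|⁻¹ Σ_k Ω[k]` on the time slice** — the average of the Koopman operators of
the action: it is idempotent, self-adjoint, and commutes with every `T`-invariant kernel operator (Serre's projection
onto the invariants). [cite: tHooft1979Flux, §5 (5.2)] [cite: Serre1977, §2.6 Thm 8 (ii)] -/
theorem averagingProjection_props (hK : StronglyMeasurable (uncurry K))
    (hA : ∀ φ : Lp ℝ 2 μ, (A φ : X → ℝ) =ᵐ[μ] fun x => ∫ y, K x y * φ y ∂μ)
    (hT : ∀ k, MeasurePreserving (T k) μ μ) (hT0 : T 0 = id) (hTadd : ∀ k k' x, T (k + k') x = T k (T k' x))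
    (hKT : ∀ k x y, K (T k x) (T k y) = K x y) :
    let P : Lp ℝ 2 μ →L[ℝ] Lp ℝ 2 μ :=
      (Fintype.card Γ : ℝ)⁻¹ • ∑ k, (Lp.compMeasurePreservingₗᵢ ℝ (T k) (hT k)).toContinuousLinearMap
    P * A = A * P ∧ P * P = P ∧ IsSelfAdjoint P := by
  intro P
  have hcard : (Fintype.card Γ : ℝ) ≠ 0 := Nat.cast_ne_zero.2 Fintype.card_ne_zero
  have hPapp : ∀ f : Lp ℝ 2 μ, P f = (Fintype.card Γ : ℝ)⁻¹ • ∑ k, Lp.compMeasurePreserving (T k) (hT k) f := by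
    intro f
    simp only [P, smul_apply, _root_.sum_apply]
    rfl
  refine ⟨?_, ?_, ?_⟩
  · -- commutes with `A`
    refine ContinuousLinearMap.ext fun f => ?_
    rw [mul_apply_eq_comp, mul_apply_eq_comp, hPapp, hPapp, map_smul, map_sum]
    congr 1
    exact Finset.sum_congr rfl fun k _ => (kernelOp_compMeasurePreserving_action hK hA hT hT0 hTadd hKT k f).symm
  · -- idempotent
    refine ContinuousLinearMap.ext fun f => ?_
    rw [mul_apply_eq_comp, hPapp (P f), hPapp f]
    have hinner : ∀ k : Γ, ∑ k', Lp.compMeasurePreserving (T k) (hT k) (Lp.compMeasurePreserving (T k') (hT k') f) =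
        ∑ j, Lp.compMeasurePreserving (T j) (hT j) f := fun k => by
      simp_rw [compMeasurePreserving_action_add hT hTadd]
      exact Fintype.sum_equiv (Equiv.addRight k) _ _ fun k' => rfl
    have h1 : ∀ k : Γ, Lp.compMeasurePreserving (T k) (hT k)
        ((Fintype.card Γ : ℝ)⁻¹ • ∑ k', Lp.compMeasurePreserving (T k') (hT k') f) =
        (Fintype.card Γ : ℝ)⁻¹ • ∑ j, Lp.compMeasurePreserving (T j) (hT j) f := fun k => by
      rw [compMeasurePreserving_action_smul, map_sum, hinner]
    simp_rw [h1]
    rw [Finset.sum_const, Finset.card_univ, ← Nat.cast_smul_eq_nsmul ℝ, smul_smul, smul_smul,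
      inv_mul_cancel₀ hcard, one_mul]
  · -- self-adjoint
    rw [ContinuousLinearMap.isSelfAdjoint_iff_isSymmetric]
    intro f g
    change ⟪P f, g⟫ = ⟪f, P g⟫
    rw [hPapp, hPapp, real_inner_smul_left, real_inner_smul_right, sum_inner, inner_sum]
    congr 1
    simp_rw [inner_compMeasurePreserving_action hT hT0 hTadd]
    exact Fintype.sum_equiv (Equiv.neg Γ) _ _ fun k => rfl

/-- The complex `ψ = 0` flux sector of the companion file is the real average: 
`(|Γ|⁻¹ Σ_k conj 0(k) · z k n).re = |Γ|⁻¹ Σ_k z k n`. [cite: tHooft1979Flux, §5 (5.2)–(5.4)] -/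
theorem re_fluxSector_zero_eq (z : Γ → ℕ → ℝ) (n : ℕ) :
    ((Fintype.card Γ : ℂ)⁻¹ * ∑ k, (starRingEnd ℂ) ((0 : AddChar Γ ℂ) k) * (z k n : ℂ)).re =
      (Fintype.card Γ : ℝ)⁻¹ * ∑ k, z k n := by
  simp only [AddChar.zero_apply, map_one, one_mul]
  rw [← Complex.ofReal_natCast, ← Complex.ofReal_inv, ← Complex.ofReal_sum, ← Complex.ofReal_mul, Complex.ofReal_re]

/-- ★★ **THE FLUX-FREE SECTOR IS A SPECTRAL TRACE WITH INTEGER MULTIPLICITIES.**  Let `K` be a bounded, strongly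
measurable, symmetric kernel of positive type on a finite measure space, invariant under a measure-preserving action
`T` of a finite abelian group `Γ`, with `L²` operator `A` and an eigenbasis `A bᵢ = λᵢ bᵢ`; let
`z k (M+2) = ∫ (κ^{[M+1]} K(·,x))(T_k x) dμ` be the twisted cyclic traces (`Tr(U_{T_k} A^{M+2})`).  Then there are
`ν_j ≥ 0` (the eigenvalues of the compressed operator `A P`, `P = |Γ|⁻¹ Σ_k U_{T_k}`, along a Hilbert basis of its
eigenvectors) with `Σ_j ν_j² < ∞` and, for every `M`,
`|Γ|⁻¹ Σ_k z k (M+2) = Σ_j ν_j^{M+2}` — 't Hooft's `e^{−βF(0)} = Tr P(0) e^{−βH}` as an honest trace of the positive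
operator `P 𝕋 P`, every eigenvalue counted with its multiplicity. [cite: tHooft1979Flux, §5 (5.1)–(5.3)]
[cite: ReedSimonI1980, Thm. VI.16 and Thm. VI.22–24] -/
theorem exists_spectralData_fluxSector_zero [Countable ι] (hK : StronglyMeasurable (uncurry K))
    (hC : ∀ x y, ‖K x y‖ ≤ C) (hsymm : ∀ x y, K x y = K y x)
    (hpt : ∀ f : X → ℝ, Measurable f → (∀ x, |f x| ≤ 1) → 0 ≤ ∫ x, ∫ y, f x * K x y * f y ∂μ ∂μ)
    (hA : ∀ φ : Lp ℝ 2 μ, (A φ : X → ℝ) =ᵐ[μ] fun x => ∫ y, K x y * φ y ∂μ)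
    (hb : ∀ i, A (b i) = lam i • b i) (hT : ∀ k, MeasurePreserving (T k) μ μ) (hT0 : T 0 = id)
    (hTadd : ∀ k k' x, T (k + k') x = T k (T k' x)) (hKT : ∀ k x y, K (T k x) (T k y) = K x y)
    {z : Γ → ℕ → ℝ}
    (hz : ∀ k M, z k (M + 2) =
      ∫ x, ((fun f : X → ℝ => fun w => ∫ y, K w y * f y ∂μ)^[M + 1] (fun y => K y x)) (T k x) ∂μ) :
    ∃ (s : Set (Lp ℝ 2 μ)) (ν : s → ℝ), (∀ j, 0 ≤ ν j) ∧ Summable (fun j => ν j ^ 2) ∧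
      ∀ M : ℕ, HasSum (fun j => ν j ^ (M + 2)) ((Fintype.card Γ : ℝ)⁻¹ * ∑ k, z k (M + 2)) := by
  classical
  -- the averaging projection
  set P : Lp ℝ 2 μ →L[ℝ] Lp ℝ 2 μ :=
    (Fintype.card Γ : ℝ)⁻¹ • ∑ k, (Lp.compMeasurePreservingₗᵢ ℝ (T k) (hT k)).toContinuousLinearMap with hPdef
  obtain ⟨hPA, hPP, hPsa⟩ : P * A = A * P ∧ P * P = P ∧ IsSelfAdjoint P :=
    averagingProjection_props hK hA hT hT0 hTadd hKT
  have hPapp : ∀ f : Lp ℝ 2 μ, P f = (Fintype.card Γ : ℝ)⁻¹ • ∑ k, Lp.compMeasurePreserving (T k) (hT k) f := by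
    intro f
    simp only [hPdef, smul_apply, _root_.sum_apply]
    rfl
  -- `A` is compact, self-adjoint, positive, Hilbert–Schmidt
  set C' := max C 0 with hC'
  have hC'' : ∀ x y, ‖K x y‖ ≤ C' := fun x y => (hC x y).trans (le_max_left _ _)
  have hcpt : IsCompactOperator A := isCompactOperator_kernelOp hC'' (le_max_right _ _) hA
  have hAsa : IsSelfAdjoint A := isSelfAdjoint_kernelOp hK hC hsymm hA
  have hApos : ∀ φ : Lp ℝ 2 μ, 0 ≤ ⟪φ, A φ⟫ := inner_kernelOp_self_nonneg hA hpt
  have hlam : Summable fun i => lam i ^ 2 := (hasSum_lam_sq hK hC hA hb).summable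
  -- the eigenbasis of `A P`
  obtain ⟨s, b', ν, -, hb'⟩ := exists_eigenbasis_mul_proj hcpt hAsa hPsa hPA
  refine ⟨s, ν, fun j => eigenvalue_mul_proj_nonneg hApos hPA hPP (b'.orthonormal.norm_eq_one j) (hb' j),
    summable_sq_eigenvalues_mul_proj b b' hb hlam hPA hb', fun M => ?_⟩
  -- the flux-free trace along the eigenbasis of `A`
  have hk : ∀ k, HasSum (fun i => lam i ^ M *
      ∫ x, (∫ w, K (T k x) w * b i w ∂μ) * (∫ w, K x w * b i w ∂μ) ∂μ) (z k (M + 2)) := fun k => by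
    rw [hz k M]
    exact hasSum_pow_integral_iterate_twisted hK hC hsymm hA hb (hT k).measurable M
  have hsum : HasSum (fun i => (Fintype.card Γ : ℝ)⁻¹ * ∑ k, (lam i ^ M *
      ∫ x, (∫ w, K (T k x) w * b i w ∂μ) * (∫ w, K x w * b i w ∂μ) ∂μ)) ((Fintype.card Γ : ℝ)⁻¹ * ∑ k, z k (M + 2)) :=
    (hasSum_sum fun k (_ : k ∈ Finset.univ) => hk k).mul_left _
  refine hasSum_pow_eigenvalues_of_hasSum_inner b b' hb hlam hPA hPP hb' M (hsum.congr_fun fun i => ?_)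
  -- termwise: `⟪P A^{M+1} bᵢ, A bᵢ⟫ = λᵢ^M · |Γ|⁻¹ Σ_k ∫ cᵢ(T_k x) cᵢ(x) dμ`, both being `|Γ|⁻¹ Σ_k λᵢ^{M+2} ⟪U_k bᵢ, bᵢ⟫`
  have hg : ∀ k, ∫ x, (∫ w, K (T k x) w * b i w ∂μ) * (∫ w, K x w * b i w ∂μ) ∂μ =
      lam i * (lam i * ⟪Lp.compMeasurePreserving (T k) (hT k) (b i), b i⟫) := fun k => by
    rw [← inner_compMeasurePreserving_kernelOp hA hT k (b i), hb, compMeasurePreserving_action_smul,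
      real_inner_smul_left, real_inner_smul_right]
  have hl : ∀ k, ⟪Lp.compMeasurePreserving (T k) (hT k) (b i), A (b i)⟫ =
      lam i * ⟪Lp.compMeasurePreserving (T k) (hT k) (b i), b i⟫ := fun k => by
    rw [hb, real_inner_smul_right]
  rw [mul_apply_eq_comp, pow_apply_of_apply_eq_smul (hb i) (M + 1), map_smul, real_inner_smul_left, hPapp,
    real_inner_smul_left, sum_inner]
  simp_rw [hl, hg]
  simp only [Finset.mul_sum]
  exact Finset.sum_congr rfl fun k _ => by ring

end Sector

end Literature.Analysis.OperatorTheory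

end
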